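import Literature.MathematicalPhysics.QuantumFieldTheory.Balaban1983to89.B9Thm314Thm315RecordDE

/-!
# `Balaban1983to89.B9Thm314WholeCancellationPair` — [B9] Theorem 3.14 (p. 427) «in the difference they are cancelled» AS ALGEBRA: the located
# approximation identity `ExpansionReads` for the DIFFERENCE letter O₁ − O₂ over the pair's surviving walks FOLLOWS from the two expansions'
# approximation identities over their FULL walk sets and the exact coincidence of the inner walk terms

T. Bałaban, *Propagators for lattice gauge theories in a background field*, Commun. Math. Phys. **99** (1985) 389–434
[`Balaban1985BackgroundPropagators`, "B9"].

statement-level skeleton of published theorems with citation tags; proofs where landed; nothing here is a claim about the Yang–Mills mass gap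

THE PRINTED LOCUS (verbatim, p. 427, proof of Theorem 3.14): *"We take random walk expansions for both operators. Terms of these expansions are
the same for walks which have all localizations contained in Ω, or Ω^{(k)}, thus in the difference they are cancelled and we have walks with at
least one localization intersecting Ωᶜ."*

THE POINT.  `B9Thm314WholeCancellation.dominatedBySums_kernelFamilyB` ∕ `B9Thm314WholeCancellationLayer.hdom_layerOfLetters` prove the domination
reading of rows 22–23 from ONE located hypothesis `ExpansionReads i cfg O T W U` about the difference letter `O` with the pair's walk terms
`pairOp P₁ P₂ T₁ T₂` over the pair's walk sets `pairWalkSets W₁ W₂ P₁ P₂` (the walks of either sequence touching Ωᶜ).  THIS FILE derives that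
hypothesis — for `O := O₁ − O₂` and the SIGNED pair terms `pairOp P₁ P₂ T₁ (negOp T₂)` — from print's two ingredients:
* the two expansions read on the read sets over their FULL walk sets, in the EVENTUAL form a norm-convergent series has (`ExpansionReadsEv i cfg Oⱼ Tⱼ
  Wⱼ U`: for every ε > 0 the partial sums `Σ_{k<m} Σ_{ω ∈ Wⱼ k y y′} (Tⱼ ω)(U)Ψ` are ε-close to `Oⱼ(U)Ψ` on the read set for ALL large m) — the located
  content of Theorem 3.10's (3.107) for G of {Ω_j} and of {Ω′_j} separately;
* the CANCELLATION `InnerTermsAgree`: at every length k the sums of the two expansions' terms over the walks NOT touching Ωᶜ coincide (print: the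
  terms themselves coincide walk by walk).
§1 `ApproxEv` (eventual form) with `ApproxEv.approxOn ∕ .sub`; `ExpansionReadsEv` with `.toExpansionReads`.  §2 `negOp`, the splitting of the pair's
partial sums (`sum_pairWalkSets_op`, `partialOp_pair_eq_sub`).  §3 ★★ `expansionReads_sub_of_cancel : ExpansionReadsEv … O₁ T₁ W₁ U → ExpansionReadsEv …
O₂ T₂ W₂ U → InnerTermsAgree … → ExpansionReads i cfg (fun V => O₁ V − O₂ V) (pairOp P₁ P₂ T₁ (negOp T₂)) (pairWalkSets W₁ W₂ P₁ P₂) U`.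
§4 at def-Y v3's record: `KdiffY … x = fun U => GAv2Y … U − GAsndY … U` is LITERALLY of this shape (`Node00.OpsYSectDE`), so
★★ `thm314_pair_opsYOfRecordDE_of_cancel` = `B9Thm314Thm315RecordDE.thm314_pair_opsYOfRecordDE` with its `hexp` binder SUPPLIED from per-sequence
data: `hE₁ hE₂` (the two expansions of G for {Ω_j} ∕ {Ω′_j} read on the read sets, eventual form) and `hcancel` (the inner terms agree).

HONEST SCOPE.  Finite-sum algebra + an ε∕2 argument (kernel-checked); the two per-sequence approximation identities and the inner coincidence stay
displayed hypotheses of located shape; nothing of print asserted; no expansion constructed; NOT a node discharge, NOT summit progress; one finite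
lattice paper; nothing continuum, nothing about the mass gap.  Cell `pub-ymgap` (D-0062), node N06 [B9], N06-ASSIGNMENT v1 rows 22–23 (successor file
of bundle F8), seat `pub-ymgap-dag-n06-m` (g3), 2026-08-27.
-/

noncomputable section

namespace Literature.MathematicalPhysics.QuantumFieldTheory.Balaban1983to89.B9Thm314WholeCancellationPair

open Finset
open B6GlobalChartV1 (PV blkV1)
open B6KLevelCensusIndexV1 (KIdx)
open B6Ineq2142KLevelV1 (β)
open B9GeoNormsKLevelV1 (geo9K)
open Node00 (FBondY CfgY BallY BondOpY)
open B9Thm314WholeReadingLattice (nb1)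
open B9Thm314WholeExpansionReads (probes ApproxOn partialOp ExpansionReads)
open B9Thm314WholePair (pairExpansion)
open B9Thm314WholePairWalks (pairWalkSets)
open B9Thm314WholeCancellationLayer (pairOp)

variable {d ℓ : ℕ} {hd : 1 ≤ d + 1} {hL : Odd (ℓ + 1) ∧ 1 < ℓ + 1} {b₀ b₁ : ℝ}
variable {𝔸 : Type} [NormedRing 𝔸] [NormedAlgebra ℂ 𝔸] [CompleteSpace 𝔸]
variable {i : KIdx d ℓ hd hL b₀ b₁}

/-! ## §1 The eventual form of the approximation and of the reading -/

/-- **EVENTUAL ε-APPROXIMATION ON A SET**: for every ε > 0 the members `P m` are ε-close to `Φ` on `S` for ALL sufficiently large m — what norm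
convergence of a series on a finite lattice gives. [cite: Balaban1985BackgroundPropagators, Thm 3.10 proof p.416 («convergent in all norms»), bookkeeping] -/
def ApproxEv (S : Set (FBondY i)) (Φ : FBondY i → 𝔸) (P : ℕ → FBondY i → 𝔸) : Prop :=
  ∀ ε : ℝ, 0 < ε → ∃ m₀, ∀ m, m₀ ≤ m → ∀ x ∈ S, ‖Φ x - P m x‖ ≤ ε

omit [NormedAlgebra ℂ 𝔸] [CompleteSpace 𝔸] in
/-- the eventual form implies the form `ExpansionReads` uses. [cite: Balaban1985BackgroundPropagators, Thm 3.10 proof p.416, bookkeeping] -/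
theorem ApproxEv.approxOn {S : Set (FBondY i)} {Φ : FBondY i → 𝔸} {P : ℕ → FBondY i → 𝔸} (h : ApproxEv S Φ P) :
    ApproxOn i S Φ P := fun ε hε => by
  obtain ⟨m₀, hm₀⟩ := h ε hε
  exact ⟨m₀, hm₀ m₀ le_rfl⟩

omit [NormedAlgebra ℂ 𝔸] [CompleteSpace 𝔸] in
/-- **DIFFERENCES**: eventual approximations of Φ₁ by P₁ and of Φ₂ by P₂ give one of Φ₁ − Φ₂ by P₁ − P₂ (ε∕2 + ε∕2, common threshold).
[cite: Balaban1985BackgroundPropagators, Thm 3.14 proof p.427 («in the difference»), bookkeeping] -/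
theorem ApproxEv.sub {S : Set (FBondY i)} {Φ₁ Φ₂ : FBondY i → 𝔸} {P₁ P₂ : ℕ → FBondY i → 𝔸} (h₁ : ApproxEv S Φ₁ P₁) (h₂ : ApproxEv S Φ₂ P₂) :
    ApproxEv S (fun x => Φ₁ x - Φ₂ x) (fun m x => P₁ m x - P₂ m x) := by
  intro ε hε
  obtain ⟨m₁, hm₁⟩ := h₁ (ε / 2) (half_pos hε)
  obtain ⟨m₂, hm₂⟩ := h₂ (ε / 2) (half_pos hε)
  refine ⟨max m₁ m₂, fun m hm x hx => ?_⟩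
  have e₁ := hm₁ m ((le_max_left _ _).trans hm) x hx
  have e₂ := hm₂ m ((le_max_right _ _).trans hm) x hx
  calc ‖Φ₁ x - Φ₂ x - (P₁ m x - P₂ m x)‖ = ‖(Φ₁ x - P₁ m x) - (Φ₂ x - P₂ m x)‖ := by congr 1; abel
    _ ≤ ‖Φ₁ x - P₁ m x‖ + ‖Φ₂ x - P₂ m x‖ := norm_sub_le _ _
    _ ≤ ε := by linarith

variable {B : B9.Backgrounds} {E₁ E₂ : B9.RWExpansion (geo9K i) B}

/-- **THE EXPANSION READ ON THE READ SETS, EVENTUAL FORM** (the three clauses of `ExpansionReads` with `ApproxEv`): what one expansion (3.107) of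
one operator delivers over its FULL walk sets. [cite: Balaban1985BackgroundPropagators, Thm 3.10 (3.107) p.415 + p.416] -/
structure ExpansionReadsEv {E : B9.RWExpansion (geo9K i) B} (cfg : B.Cfg → CfgY 𝔸 i) (O : BondOpY 𝔸 i) (T : E.Walk → BondOpY 𝔸 i)
    (W : ℕ → (geo9K i).Site → (geo9K i).Site → Finset E.Walk) (U : B.Cfg) : Prop where
  sup : ∀ (y y' : (geo9K i).Site) (J : FBondY i → ℝ), (geo9K i).suppIn (Sum.inr J) y' → ∀ (e : BallY 𝔸),
    ∀ Ψ ∈ probes i (cfg U) J (e : 𝔸),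
      ApproxEv (nb1 i (nb1 i {x | blkV1 i.hN i.D x = β i.hN i.D i.hk y})) (O (cfg U) Ψ) (partialOp i W T (cfg U) y y' Ψ)
  holder : ∀ (y y' : (geo9K i).Site) (J : FBondY i → ℝ), (geo9K i).suppIn (Sum.inr J) y' → ∀ z : FBondY i → ℝ,
    (geo9K i).cutIn (Sum.inr z) y → ∀ (e : BallY 𝔸), ∀ Ψ ∈ probes i (cfg U) J (e : 𝔸),
      ApproxEv (nb1 i {x | z x ≠ 0}) (O (cfg U) Ψ) (partialOp i W T (cfg U) y y' Ψ)
  l2 : ∀ (y y' : (geo9K i).Site) (J : FBondY i → ℝ), (geo9K i).suppIn (Sum.inr J) y' → ∀ h : FBondY i → ℝ,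
    (geo9K i).cutIn (Sum.inr h) y → ∀ (e : BallY 𝔸), ∀ Ψ ∈ probes i (cfg U) J (e : 𝔸),
      ApproxEv (nb1 i (nb1 i {x | h x ≠ 0})) (O (cfg U) Ψ) (partialOp i W T (cfg U) y y' Ψ)

/-- the eventual reading implies the reading. [cite: Balaban1985BackgroundPropagators, Thm 3.10 proof p.416, bookkeeping] -/
theorem ExpansionReadsEv.toExpansionReads {E : B9.RWExpansion (geo9K i) B} {cfg : B.Cfg → CfgY 𝔸 i} {O : BondOpY 𝔸 i}
    {T : E.Walk → BondOpY 𝔸 i} {W : ℕ → (geo9K i).Site → (geo9K i).Site → Finset E.Walk} {U : B.Cfg}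
    (h : ExpansionReadsEv cfg O T W U) : ExpansionReads i cfg O T W U :=
  ⟨fun y y' J hs e Ψ hΨ => (h.sup y y' J hs e Ψ hΨ).approxOn, fun y y' J hs z hc e Ψ hΨ => (h.holder y y' J hs z hc e Ψ hΨ).approxOn,
    fun y y' J hs hh hc e Ψ hΨ => (h.l2 y y' J hs hh hc e Ψ hΨ).approxOn⟩

/-! ## §2 The signed pair terms and the splitting of the pair's partial sums -/

/-- the second expansion's terms WITH THE SIGN OF THE DIFFERENCE: `(negOp T₂) ω U := −(T₂ ω U)`.
[cite: Balaban1985BackgroundPropagators, Thm 3.14 proof p.427, bookkeeping] -/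
def negOp (T₂ : E₂.Walk → BondOpY 𝔸 i) : E₂.Walk → BondOpY 𝔸 i := fun ω U => -(T₂ ω U)

omit [CompleteSpace 𝔸] in
open Classical in
/-- a sum over the pair's walk set of an additive-monoid-valued Sum.elim splits into the two filtered sums.
[cite: Balaban1985BackgroundPropagators, Thm 3.14 proof p.427 (bookkeeping)] -/
theorem sum_pairWalkSets_op {M : Type} [AddCommMonoid M] (W₁ : ℕ → (geo9K i).Site → (geo9K i).Site → Finset E₁.Walk)
    (W₂ : ℕ → (geo9K i).Site → (geo9K i).Site → Finset E₂.Walk) (P₁ : E₁.Walk → Prop) (P₂ : E₂.Walk → Prop)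
    (q₁ : E₁.Walk → M) (q₂ : E₂.Walk → M) (n : ℕ) (y y' : (geo9K i).Site) :
    ∑ ω ∈ pairWalkSets W₁ W₂ P₁ P₂ n y y', Sum.elim (fun ω => q₁ ω.1) (fun ω => q₂ ω.1) ω =
      ∑ ω ∈ (W₁ n y y').filter P₁, q₁ ω + ∑ ω ∈ (W₂ n y y').filter P₂, q₂ ω := by
  show ∑ ω ∈ ((W₁ n y y').subtype P₁).disjSum ((W₂ n y y').subtype P₂),
      Sum.elim (fun ω : {ω : E₁.Walk // P₁ ω} => q₁ ω.1) (fun ω : {ω : E₂.Walk // P₂ ω} => q₂ ω.1) ω = _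
  rw [Finset.sum_disjSum]
  simp only [Sum.elim_inl, Sum.elim_inr]
  rw [Finset.sum_subtype_eq_sum_filter (f := q₁), Finset.sum_subtype_eq_sum_filter (f := q₂)]

open Classical in
/-- **THE INNER WALK TERMS OF THE TWO EXPANSIONS AGREE** (print: *"Terms of these expansions are the same for walks which have all
localizations contained in Ω"*): at every length, between every pair of coarse sites and on every input, the sum of the first expansion's
terms over its walks NOT touching Ωᶜ equals the same sum for the second expansion.  A hypothesis schema of located shape.
[cite: Balaban1985BackgroundPropagators, Thm 3.14 proof p.427] -/
def InnerTermsAgree (W₁ : ℕ → (geo9K i).Site → (geo9K i).Site → Finset E₁.Walk) (W₂ : ℕ → (geo9K i).Site → (geo9K i).Site → Finset E₂.Walk)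
    (P₁ : E₁.Walk → Prop) (P₂ : E₂.Walk → Prop) (T₁ : E₁.Walk → BondOpY 𝔸 i) (T₂ : E₂.Walk → BondOpY 𝔸 i) (Uc : CfgY 𝔸 i) : Prop :=
  ∀ (k : ℕ) (y y' : (geo9K i).Site) (Ψ : FBondY i → 𝔸),
    (∑ ω ∈ (W₁ k y y').filter (fun ω => ¬ P₁ ω), T₁ ω Uc Ψ) = ∑ ω ∈ (W₂ k y y').filter (fun ω => ¬ P₂ ω), T₂ ω Uc Ψ

open Classical in
/-- **THE PAIR'S PARTIAL SUMS ARE THE DIFFERENCE OF THE TWO FULL PARTIAL SUMS** once the inner terms agree: the surviving terms of the first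
expansion minus those of the second = all terms of the first minus all of the second (the inner ones cancel).
[cite: Balaban1985BackgroundPropagators, Thm 3.14 proof p.427] -/
theorem partialOp_pair_eq_sub (W₁ : ℕ → (geo9K i).Site → (geo9K i).Site → Finset E₁.Walk)
    (W₂ : ℕ → (geo9K i).Site → (geo9K i).Site → Finset E₂.Walk) (P₁ : E₁.Walk → Prop) (P₂ : E₂.Walk → Prop)
    (T₁ : E₁.Walk → BondOpY 𝔸 i) (T₂ : E₂.Walk → BondOpY 𝔸 i) (Uc : CfgY 𝔸 i) (hc : InnerTermsAgree W₁ W₂ P₁ P₂ T₁ T₂ Uc)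
    (y y' : (geo9K i).Site) (Ψ : FBondY i → 𝔸) (m : ℕ) :
    partialOp i (pairWalkSets W₁ W₂ P₁ P₂) (pairOp P₁ P₂ T₁ (negOp T₂)) Uc y y' Ψ m =
      partialOp i W₁ T₁ Uc y y' Ψ m - partialOp i W₂ T₂ Uc y y' Ψ m := by
  unfold partialOp
  rw [← Finset.sum_sub_distrib]
  refine Finset.sum_congr rfl fun k _ => ?_
  have hsplit : ∑ ω ∈ pairWalkSets W₁ W₂ P₁ P₂ k y y', (pairOp P₁ P₂ T₁ (negOp T₂) ω) Uc Ψ =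
      ∑ ω ∈ (W₁ k y y').filter P₁, T₁ ω Uc Ψ + ∑ ω ∈ (W₂ k y y').filter P₂, (negOp T₂ ω) Uc Ψ := by
    rw [← sum_pairWalkSets_op W₁ W₂ P₁ P₂ (fun ω => T₁ ω Uc Ψ) (fun ω => (negOp T₂ ω) Uc Ψ)]
    refine Finset.sum_congr rfl ?_
    rintro (ω | ω) - <;> rfl
  rw [hsplit]
  have h₁ : (∑ ω ∈ (W₁ k y y').filter P₁, T₁ ω Uc Ψ) + ∑ ω ∈ (W₁ k y y').filter (fun ω => ¬ P₁ ω), T₁ ω Uc Ψ =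
      ∑ ω ∈ W₁ k y y', T₁ ω Uc Ψ := Finset.sum_filter_add_sum_filter_not _ _ _
  have h₂ : (∑ ω ∈ (W₂ k y y').filter P₂, T₂ ω Uc Ψ) + ∑ ω ∈ (W₂ k y y').filter (fun ω => ¬ P₂ ω), T₂ ω Uc Ψ =
      ∑ ω ∈ W₂ k y y', T₂ ω Uc Ψ := Finset.sum_filter_add_sum_filter_not _ _ _
  have hneg : ∑ ω ∈ (W₂ k y y').filter P₂, (negOp T₂ ω) Uc Ψ = -∑ ω ∈ (W₂ k y y').filter P₂, T₂ ω Uc Ψ := by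
    rw [← Finset.sum_neg_distrib]
    exact Finset.sum_congr rfl fun ω _ => by simp [negOp]
  rw [hneg, ← h₁, ← h₂, hc k y y' Ψ]
  abel

/-! ## §3 The difference letter is read on the read sets -/

/-- the pair's approximation on one read set, from the two eventual approximations and the cancellation.
[cite: Balaban1985BackgroundPropagators, Thm 3.14 proof p.427] -/
private theorem approxOn_pair {S : Set (FBondY i)} (W₁ : ℕ → (geo9K i).Site → (geo9K i).Site → Finset E₁.Walk)
    (W₂ : ℕ → (geo9K i).Site → (geo9K i).Site → Finset E₂.Walk) (P₁ : E₁.Walk → Prop) (P₂ : E₂.Walk → Prop)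
    (T₁ : E₁.Walk → BondOpY 𝔸 i) (T₂ : E₂.Walk → BondOpY 𝔸 i) (O₁ O₂ : BondOpY 𝔸 i) (Uc : CfgY 𝔸 i)
    (hc : InnerTermsAgree W₁ W₂ P₁ P₂ T₁ T₂ Uc) (y y' : (geo9K i).Site) (Ψ : FBondY i → 𝔸)
    (h₁ : ApproxEv S (O₁ Uc Ψ) (partialOp i W₁ T₁ Uc y y' Ψ)) (h₂ : ApproxEv S (O₂ Uc Ψ) (partialOp i W₂ T₂ Uc y y' Ψ)) :
    ApproxOn i S ((O₁ Uc - O₂ Uc) Ψ) (partialOp i (pairWalkSets W₁ W₂ P₁ P₂) (pairOp P₁ P₂ T₁ (negOp T₂)) Uc y y' Ψ) := by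
  have key : ApproxEv S ((O₁ Uc - O₂ Uc) Ψ) (partialOp i (pairWalkSets W₁ W₂ P₁ P₂) (pairOp P₁ P₂ T₁ (negOp T₂)) Uc y y' Ψ) := by
    intro ε hε
    obtain ⟨m₀, hm₀⟩ := (h₁.sub h₂) ε hε
    refine ⟨m₀, fun m hm x hx => ?_⟩
    have := hm₀ m hm x hx
    rw [partialOp_pair_eq_sub W₁ W₂ P₁ P₂ T₁ T₂ Uc hc]
    simpa only [LinearMap.sub_apply, Pi.sub_apply] using this
  exact key.approxOn

/-- ★★ **«IN THE DIFFERENCE THEY ARE CANCELLED» AS ALGEBRA**: if each of the two expansions is read on the read sets over its full walk sets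
(eventual form) and the inner walk terms agree, then the DIFFERENCE letter `U ↦ O₁ U − O₂ U` is read on the read sets through the signed pair
terms over the pair's surviving walks — i.e. the hypothesis `ExpansionReads` of `B9Thm314WholeCancellation.dominatedBySums_kernelFamilyB` ∕
`B9Thm314WholeCancellationLayer.hdom_layerOfLetters` ∕ `B9Thm314Thm315RecordDE.thm314_pair_opsYOfRecordDE` holds (there with `KdiffY … x =
fun U => GAv2Y … U − GAsndY … U`, definitionally of this shape). [cite: Balaban1985BackgroundPropagators, Thm 3.14 proof p.427] -/
theorem expansionReads_sub_of_cancel {cfg : B.Cfg → CfgY 𝔸 i} {O₁ O₂ : BondOpY 𝔸 i}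
    {W₁ : ℕ → (geo9K i).Site → (geo9K i).Site → Finset E₁.Walk} {W₂ : ℕ → (geo9K i).Site → (geo9K i).Site → Finset E₂.Walk}
    {P₁ : E₁.Walk → Prop} {P₂ : E₂.Walk → Prop} {T₁ : E₁.Walk → BondOpY 𝔸 i} {T₂ : E₂.Walk → BondOpY 𝔸 i} {U : B.Cfg}
    (h₁ : ExpansionReadsEv cfg O₁ T₁ W₁ U) (h₂ : ExpansionReadsEv cfg O₂ T₂ W₂ U) (hc : InnerTermsAgree W₁ W₂ P₁ P₂ T₁ T₂ (cfg U)) :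
    ExpansionReads i cfg (fun V => O₁ V - O₂ V) (pairOp P₁ P₂ T₁ (negOp T₂)) (pairWalkSets W₁ W₂ P₁ P₂) U where
  sup y y' J hs e Ψ hΨ := approxOn_pair W₁ W₂ P₁ P₂ T₁ T₂ O₁ O₂ (cfg U) hc y y' Ψ (h₁.sup y y' J hs e Ψ hΨ) (h₂.sup y y' J hs e Ψ hΨ)
  holder y y' J hs z hz e Ψ hΨ :=
    approxOn_pair W₁ W₂ P₁ P₂ T₁ T₂ O₁ O₂ (cfg U) hc y y' Ψ (h₁.holder y y' J hs z hz e Ψ hΨ) (h₂.holder y y' J hs z hz e Ψ hΨ)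
  l2 y y' J hs hh hc' e Ψ hΨ :=
    approxOn_pair W₁ W₂ P₁ P₂ T₁ T₂ O₁ O₂ (cfg U) hc y y' Ψ (h₁.l2 y y' J hs hh hc' e Ψ hΨ) (h₂.l2 y y' J hs hh hc' e Ψ hΨ)

/-! ## §4 At def-Y v3's instance of record: rows 22 ∧ 23 from per-sequence expansion readings and the cancellation -/

section Record

open B9 B9Thm314 B9FromB6ModelSignsOn
open B9PinMembersKLevelV1 (MemberY geo9Y bg9Y)
open B9PinGeometryKLevelV1 (kLab dOmegaY OmKY c35Y)
open B9Thm314GpFlatTorusGeometry (tdistK OmegaC)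
open B9Thm314WholePinGeometry (locDataY)
open B9Thm314WholePair (locData₂)
open B9Thm314WholeSummation (WalkSetsSpec WalkWeightsSummable)
open B9SectCWalkTermsAllNorms (Thm310AllNormsPrinted)
open B9Thm314Thm315RecordDE (thm314_pair_opsYOfRecordDE)
open B7Prop2SpecialUnitary (specialUnitaryUnits)
open Node00 (kernelFamilyB Stage3Params ExpsY ResY GAv2Y GAsndY lettersYOfRecordDE opsYOfRecordDE)

open scoped Matrix.Norms.L2Operator

/-- ★★ **ROWS 22 ∧ 23 AT def-Y v3's INSTANCE OF RECORD FROM PER-SEQUENCE EXPANSION READINGS AND THE CANCELLATION**: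
`B9Thm314Thm315RecordDE.thm314_pair_opsYOfRecordDE` with the second expansion's terms taken with the sign of the difference (`negOp`) and its
`hexp` binder SUPPLIED by `expansionReads_sub_of_cancel` — displayed instead: `hE₁ hE₂` (the (3.107) expansions of G(U) for the member's two domain
sequences `GAv2Y … x.toKIdx`, `GAsndY … x` read on the read sets over their full walk sets, eventual form, under «the expansion converges at U») and
`hcancel` (the inner walk terms of the two expansions agree).  Everything else as there.  NOT a node discharge.
[cite: Balaban1985BackgroundPropagators, Thm 3.14 (3.154) pp.426–427 + its proof p.427] -/
theorem thm314_pair_opsYOfRecordDE_of_cancel (N : ℕ) (θ : Stage3Params) (Mstar : ℕ) (𝔯 : ResY N θ Mstar) (𝔈 : ExpsY N θ Mstar)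
    {E₁ E₂ : ∀ x : MemberY θ.d₆ θ.ℓ₆ θ.hd' θ.hL' θ.b₀ θ.b₁ Mstar,
      B9.RWExpansion (geo9Y x) (bg9Y (Matrix (Fin N) (Fin N) ℂ) (specialUnitaryUnits (Fin N)) x)}
    (T₁ : ∀ x : MemberY θ.d₆ θ.ℓ₆ θ.hd' θ.hL' θ.b₀ θ.b₁ Mstar, (E₁ x).Walk → BondOpY (Matrix (Fin N) (Fin N) ℂ) x.toKIdx)
    (T₂ : ∀ x : MemberY θ.d₆ θ.ℓ₆ θ.hd' θ.hL' θ.b₀ θ.b₁ Mstar, (E₂ x).Walk → BondOpY (Matrix (Fin N) (Fin N) ℂ) x.toKIdx)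
    (X₁ : ∀ x : MemberY θ.d₆ θ.ℓ₆ θ.hd' θ.hL' θ.b₀ θ.b₁ Mstar, (E₁ x).Walk → ℕ → (geo9Y x).Site → Prop)
    (M₁ : ∀ x : MemberY θ.d₆ θ.ℓ₆ θ.hd' θ.hL' θ.b₀ θ.b₁ Mstar, (E₁ x).Walk → ℕ → Prop)
    (X₂ : ∀ x : MemberY θ.d₆ θ.ℓ₆ θ.hd' θ.hL' θ.b₀ θ.b₁ Mstar, (E₂ x).Walk → ℕ → (geo9Y x).Site → Prop)
    (M₂ : ∀ x : MemberY θ.d₆ θ.ℓ₆ θ.hd' θ.hL' θ.b₀ θ.b₁ Mstar, (E₂ x).Walk → ℕ → Prop)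
    (diam : MemberY θ.d₆ θ.ℓ₆ θ.hd' θ.hL' θ.b₀ θ.b₁ Mstar → ℝ) (r₀ : ℝ) (hr : ∀ x, diam x ≤ r₀)
    (near₁ : ∀ (x : MemberY θ.d₆ θ.ℓ₆ θ.hd' θ.hL' θ.b₀ θ.b₁ Mstar) ω m p, M₁ x ω m → X₁ x ω m p →
      ∃ q, q ∈ OmegaC x.D x.D' ∧ tdistK (ℓ := θ.ℓ₆) (Mh := x.Mh) (k := x.k) (P := x.P') (kLab x p) q ≤ diam x)
    (first₁ : ∀ (x : MemberY θ.d₆ θ.ℓ₆ θ.hd' θ.hL' θ.b₀ θ.b₁ Mstar) ω y, (E₁ x).first ω y → X₁ x ω 0 y)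
    (chain₁ : ∀ (x : MemberY θ.d₆ θ.ℓ₆ θ.hd' θ.hL' θ.b₀ θ.b₁ Mstar) ω y y', (E₁ x).first ω y → (E₁ x).last ω y' →
      ∃ l : List (geo9Y x).Site, l.length = (E₁ x).wlen ω ∧ (∀ (m : ℕ) (hm : m < l.length), X₁ x ω (m + 1) (l[m])) ∧
        B9Thm314.chainSum (geo9Y x).dist y l y' ≤ (E₁ x).wdist ω y y')
    (near₂ : ∀ (x : MemberY θ.d₆ θ.ℓ₆ θ.hd' θ.hL' θ.b₀ θ.b₁ Mstar) ω m p, M₂ x ω m → X₂ x ω m p →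
      ∃ q, q ∈ OmegaC x.D x.D' ∧ tdistK (ℓ := θ.ℓ₆) (Mh := x.Mh) (k := x.k) (P := x.P') (kLab x p) q ≤ diam x)
    (first₂ : ∀ (x : MemberY θ.d₆ θ.ℓ₆ θ.hd' θ.hL' θ.b₀ θ.b₁ Mstar) ω y, (E₂ x).first ω y → X₂ x ω 0 y)
    (chain₂ : ∀ (x : MemberY θ.d₆ θ.ℓ₆ θ.hd' θ.hL' θ.b₀ θ.b₁ Mstar) ω y y', (E₂ x).first ω y → (E₂ x).last ω y' →
      ∃ l : List (geo9Y x).Site, l.length = (E₂ x).wlen ω ∧ (∀ (m : ℕ) (hm : m < l.length), X₂ x ω (m + 1) (l[m])) ∧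
        B9Thm314.chainSum (geo9Y x).dist y l y' ≤ (E₂ x).wdist ω y y')
    (h₁ : Thm310AllNormsPrinted c35Y geo9Y (bg9Y (Matrix (Fin N) (Fin N) ℂ) (specialUnitaryUnits (Fin N))) E₁
      (fun x ω => kernelFamilyB x.toKIdx (bg9Y (Matrix (Fin N) (Fin N) ℂ) (specialUnitaryUnits (Fin N)) x) (fun U => U) (T₁ x ω)
        (lettersYOfRecordDE N θ Mstar 𝔯 x).parB))
    (h₂ : Thm310AllNormsPrinted c35Y geo9Y (bg9Y (Matrix (Fin N) (Fin N) ℂ) (specialUnitaryUnits (Fin N))) E₂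
      (fun x ω => kernelFamilyB x.toKIdx (bg9Y (Matrix (Fin N) (Fin N) ℂ) (specialUnitaryUnits (Fin N)) x) (fun U => U) (negOp (T₂ x) ω)
        (lettersYOfRecordDE N θ Mstar 𝔯 x).parB))
    (W₁ : ∀ x : MemberY θ.d₆ θ.ℓ₆ θ.hd' θ.hL' θ.b₀ θ.b₁ Mstar, ℕ → (geo9Y x).Site → (geo9Y x).Site → Finset (E₁ x).Walk)
    (W₂ : ∀ x : MemberY θ.d₆ θ.ℓ₆ θ.hd' θ.hL' θ.b₀ θ.b₁ Mstar, ℕ → (geo9Y x).Site → (geo9Y x).Site → Finset (E₂ x).Walk)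
    (hW₁ : ∀ x, WalkSetsSpec (E₁ x) (W₁ x)) (hW₂ : ∀ x, WalkSetsSpec (E₂ x) (W₂ x))
    (hcnt₁ : WalkWeightsSummable geo9Y (bg9Y (Matrix (Fin N) (Fin N) ℂ) (specialUnitaryUnits (Fin N))) E₁ W₁)
    (hcnt₂ : WalkWeightsSummable geo9Y (bg9Y (Matrix (Fin N) (Fin N) ℂ) (specialUnitaryUnits (Fin N))) E₂ W₂)
    (hE₁ : ∀ (x : MemberY θ.d₆ θ.ℓ₆ θ.hd' θ.hL' θ.b₀ θ.b₁ Mstar) (U : (bg9Y (Matrix (Fin N) (Fin N) ℂ) (specialUnitaryUnits (Fin N)) x).Cfg),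
      (E₁ x).Converges U → ExpansionReadsEv (B := bg9Y (Matrix (Fin N) (Fin N) ℂ) (specialUnitaryUnits (Fin N)) x) (fun U => U)
        (GAv2Y (Matrix (Fin N) (Fin N) ℂ) x.toKIdx) (T₁ x) (W₁ x) U)
    (hE₂ : ∀ (x : MemberY θ.d₆ θ.ℓ₆ θ.hd' θ.hL' θ.b₀ θ.b₁ Mstar) (U : (bg9Y (Matrix (Fin N) (Fin N) ℂ) (specialUnitaryUnits (Fin N)) x).Cfg),
      (E₂ x).Converges U → ExpansionReadsEv (B := bg9Y (Matrix (Fin N) (Fin N) ℂ) (specialUnitaryUnits (Fin N)) x) (fun U => U)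
        (GAsndY (Matrix (Fin N) (Fin N) ℂ) x) (T₂ x) (W₂ x) U)
    (hcancel : ∀ (x : MemberY θ.d₆ θ.ℓ₆ θ.hd' θ.hL' θ.b₀ θ.b₁ Mstar) (U : (bg9Y (Matrix (Fin N) (Fin N) ℂ) (specialUnitaryUnits (Fin N)) x).Cfg),
      InnerTermsAgree (W₁ x) (W₂ x) (locDataY x (E₁ x) (X₁ x) (M₁ x) (diam x)).Touches
        (locData₂ (locDataY x (E₁ x) (X₁ x) (M₁ x) (diam x)) (X₂ x) (M₂ x)).Touches (T₁ x) (T₂ x) U) :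
    B9.Thm314Printed c35Y geo9Y (bg9Y (Matrix (Fin N) (Fin N) ℂ) (specialUnitaryUnits (Fin N)))
        (fun x => ((opsYOfRecordDE N θ Mstar 𝔯 𝔈) x).Kdiff) dOmegaY ∧
      B9Thm314.Thm314LocalPrinted c35Y geo9Y (bg9Y (Matrix (Fin N) (Fin N) ℂ) (specialUnitaryUnits (Fin N)))
        (fun x => ((opsYOfRecordDE N θ Mstar 𝔯 𝔈) x).Kdiff) OmKY dOmegaY :=
  thm314_pair_opsYOfRecordDE N θ Mstar 𝔯 𝔈 T₁ (fun x => negOp (T₂ x)) X₁ M₁ X₂ M₂ diam r₀ hr near₁ first₁ chain₁ near₂ first₂ chain₂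
    h₁ h₂ W₁ W₂ hW₁ hW₂ hcnt₁ hcnt₂ fun x U hU => expansionReads_sub_of_cancel (hE₁ x U hU.1) (hE₂ x U hU.2) (hcancel x U)

end Record

end Literature.MathematicalPhysics.QuantumFieldTheory.Balaban1983to89.B9Thm314WholeCancellationPair

end
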